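import Literature.Analysis.FluidPDE.KNSSRemark61
import Literature.Analysis.FluidPDE.OseenSlice
import Literature.Analysis.FluidPDE.NSBoundedMildSmoothing
import Literature.Analysis.FluidPDE.TorusHeatFlow
import Literature.Analysis.FunctionSpaces.FlatTorusProofs
import HarnessLib

/-!
# The mild formula preserves the spatial average of periodic fields

Analysis/FluidPDE proofs file (everything proved; no definitions, no named facts) on the
discharge path of `Literature.Barriers.NavierStokesRegularity.CoiculescuPalasek2025_globalExtension`
(small smooth mean-zero data on `𝕋³` launch a global classical solution; Coiculescu–Palasek 2025,
§5, last paragraph). The local solution is taken from the whole-space `L^∞` theory of the Oseen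
integral equation `v(t) = e^{tΔ}a − B¹₀(v,v)(t)` (Koch–Nadirashvili–Seregin–Šverák 2009, §4;
Giga–Inui–Matsui 1999), applied to the periodic lift `a = lift a₀` of a torus datum; to descend the
whole-space solution to a solution of the periodic problem *with periodic pressure* one needs to
know that the spatial average `∫_{𝕋³} v(t)` does not move (the linear-in-`x` part of the
whole-space pressure is `−(d/dt)∫_{𝕋³} v(t) · x`). This file computes the average of both terms
of the mild formula over the torus:

* `Torus.integral_heatExtension_lift_repr` — `∫_{𝕋ᵈ} (e^{tΔ} ã)(repr x) dx = ∫_{𝕋ᵈ} a`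
  for continuous `a : 𝕋ᵈ → F` (`e^{tΔ}ã (repr x) = ∫ G_t(z) a(x − proj z) dz`, Fubini, translation
  invariance of Haar measure on `𝕋ᵈ`, `∫ G_t = 1`);
* `Torus.integral_oseenSlice_lift_repr_eq_zero` — `∫_{𝕋ᵈ} N_τ[b̃₁, b̃₂](repr x) dx = 0` for the
  Oseen slice operator `N_τ[a, b](y) = ∫ K(τ, z)[a(y − z), b(y − z)] dz` (kernel realisation of
  `e^{τΔ}P∇·(a ⊗ b)`, `OseenSlice.lean`) on lifts of continuous torus fields: after Fubini and
  translation invariance the inner integral `Φ(z) = ∫_{𝕋ᵈ} K(τ, z)[b₁ x, b₂ x] dx` is odd in `z`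
  (`oseenKernel_neg`), so `∫ Φ = 0` — the torus form of "`e^{τΔ}P∇·` kills constants", KNSS 2009,
  §3 p. 6;
* `Torus.integral_oseenDuhamel_repr_eq_zero` — hence the Duhamel term
  `B^ν_s(v, v)(t) = ∫ₛᵗ N_{ν(t−σ)}[v(σ), v(σ)] dσ` of a bounded jointly measurable field whose
  slices on `(s, t)` are lifts of continuous torus fields has zero average over the torus (Fubini
  in `σ` under the bound `‖N_σ‖ ≲ σ^{-1/2}`).

## Mathlib / tree search

Tree (`lean search`): `UnboundedOperators.heatExtension_apply`, `integral_heatKernel_eq_one_holds`,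
`continuous_heatKernel`, `oseenSlice_eq_integral_sub`, `exists_norm_oseenKernel_le`,
`integrable_add_norm_sq_rpow_neg_half_succ`, `Measurable.oseenKernel_comp`, `oseenKernel_neg`,
`integral_oseenKernel_eq_zero` (same oddness argument, constant tensor),
`exists_norm_oseenSlice_le`, `stronglyMeasurable_oseenSlice_duhamel`,
`integrableOn_Ioo_rpow_neg_half_sub`, `Torus.lift_apply`, `Torus.proj_repr`,
`TorusHeat.exists_norm_le`. Mathlib: `integral_integral_swap`, `integral_sub_right_eq_self`,
`integral_neg_eq_self`, `Integrable.mul_prod`.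

## References

* G. Koch, N. Nadirashvili, G. Seregin, V. Šverák, Acta Math. 203 (2009) = arXiv:0709.3599,
  §3 p. 6 (the kernel of `e^{tΔ}P∇·`; the Helmholtz projection on `L^∞` "modulo constants") and
  §4 p. 8. [KochNadirashviliSereginSverak2009]
* Y. Giga, K. Inui, S. Matsui, Quaderni di Matematica 4 (1999) 27–68 (nondecaying, in particular
  periodic, data).
* M. P. Coiculescu, S. Palasek, Invent. Math. 244 (2025) = arXiv:2503.14699, §5.
  [CoiculescuPalasek2025]
-/

noncomputable section

open MeasureTheory Set Function Filter TopologicalSpace InnerProductSpace Metric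
open Literature.Analysis.FunctionSpaces
open _root_.Topology
open scoped RealInnerProductSpace NNReal ENNReal

namespace Literature.Analysis.FluidPDE

namespace Torus

variable {d : Type*} [Fintype d]
variable {F : Type*} [NormedAddCommGroup F] [NormedSpace ℝ F]

omit [Fintype d] [NormedAddCommGroup F] [NormedSpace ℝ F] in
/-- The lift read along the section `repr`: `ã(repr x − z) = a(x − proj z)`. [folklore] -/
theorem lift_repr_sub (a : UnitAddTorus d → F) (x : UnitAddTorus d) (z : EuclideanSpace ℝ d) :
    Torus.lift a (Torus.repr x - z) = a (x - Torus.proj z) := by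
  rw [Torus.lift_apply, sub_eq_add_neg, Torus.proj_add, Torus.proj_repr, Torus.proj_neg,
    ← sub_eq_add_neg]

/-! ### The caloric term -/

/-- **The heat flow of periodic data preserves the average**: for continuous `a : 𝕋ᵈ → F` and
`t > 0`, `∫_{𝕋ᵈ} (e^{tΔ}ã)(repr x) dx = ∫_{𝕋ᵈ} a`, where `ã = lift a` is the periodic lift and
`e^{tΔ}` the whole-space caloric extension (`e^{tΔ}ã (repr x) = ∫ G_t(z) a(x − proj z) dz`;
Fubini, translation invariance of the Haar measure of `𝕋ᵈ`, `∫ G_t = 1`). [folklore] -/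
theorem integral_heatExtension_lift_repr [CompleteSpace F] {a : UnitAddTorus d → F}
    (ha : Continuous a) {t : ℝ} (ht : 0 < t) :
    ∫ x, UnboundedOperators.heatExtension (Torus.lift a) t (Torus.repr x) = ∫ x, a x := by
  have h1 : ∀ x : UnitAddTorus d, UnboundedOperators.heatExtension (Torus.lift a) t (Torus.repr x) =
      ∫ z, UnboundedOperators.heatKernel t z • a (x - Torus.proj z) := by
    intro x
    rw [UnboundedOperators.heatExtension_apply]
    simp_rw [lift_repr_sub]
  simp_rw [h1]
  obtain ⟨C, -, hC⟩ := TorusHeat.exists_norm_le ha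
  -- Fubini over `𝕋ᵈ × ℝᵈ`
  have hint : Integrable (uncurry fun (x : UnitAddTorus d) (z : EuclideanSpace ℝ d) =>
      UnboundedOperators.heatKernel t z • a (x - Torus.proj z)) (volume.prod volume) := by
    refine Integrable.mono' (g := fun p => (1 : ℝ) * (UnboundedOperators.heatKernel t p.2 * C))
      ((integrable_const (1 : ℝ)).mul_prod
        ((UnboundedOperators.integrable_heatKernel_holds ht).mul_const C)) ?_ ?_
    · have hc : Continuous (uncurry fun (x : UnitAddTorus d) (z : EuclideanSpace ℝ d) =>
          UnboundedOperators.heatKernel t z • a (x - Torus.proj z)) :=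
        ((UnboundedOperators.continuous_heatKernel t).comp continuous_snd).smul
          (ha.comp (continuous_fst.sub (Torus.continuous_proj.comp continuous_snd)))
      exact hc.aestronglyMeasurable
    · refine Eventually.of_forall fun p => ?_
      simp only [uncurry, norm_smul, one_mul,
        Real.norm_of_nonneg (UnboundedOperators.heatKernel_pos ht p.2).le]
      exact mul_le_mul_of_nonneg_left (hC _) (UnboundedOperators.heatKernel_pos ht p.2).le
  rw [integral_integral_swap hint]
  have h2 : ∀ z : EuclideanSpace ℝ d,
      (∫ x, UnboundedOperators.heatKernel t z • a (x - Torus.proj z)) =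
        UnboundedOperators.heatKernel t z • ∫ x, a x := by
    intro z
    rw [integral_smul, integral_sub_right_eq_self (fun x => a x) (Torus.proj z)]
  simp_rw [h2]
  rw [integral_smul_const, UnboundedOperators.integral_heatKernel_eq_one_holds ht, one_smul]

/-! ### The Oseen slice and the Duhamel term -/

variable {E : Type*} [NormedAddCommGroup E] [InnerProductSpace ℝ E] [FiniteDimensional ℝ E]
  [MeasurableSpace E] [BorelSpace E]

/-- **The Oseen slice of periodic data has zero average**: for continuous `b₁, b₂ : 𝕋ᵈ → ℝᵈ`
and `τ > 0`, `∫_{𝕋ᵈ} N_τ[b̃₁, b̃₂](repr x) dx = 0`, where `N_τ[a, b](y) = ∫ K(τ, z)[a(y−z), b(y−z)] dz`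
is the kernel realisation of `e^{τΔ}P∇·(a ⊗ b)` (`oseenSlice`). Indeed
`N_τ[b̃₁, b̃₂](repr x) = ∫ K(τ, z)[b₁(x − proj z), b₂(x − proj z)] dz`; after Fubini (the
parabolic envelope `‖K(τ, z)‖ ≲ (τ + |z|²)^{-(d+1)/2}` is integrable, the torus has finite
measure) and translation invariance of Haar measure, the inner integral
`Φ(z) = ∫_{𝕋ᵈ} K(τ, z)[b₁ x, b₂ x] dx` is odd in `z` (`oseenKernel_neg`), whence `∫ Φ = 0`
(KNSS 2009, §3 p. 6: `e^{τΔ}P∇·` annihilates `x`-independent tensors). [cite: KochNadirashviliSereginSverak2009, §3 p. 6 (arXiv:0709.3599v1)] -/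
theorem integral_oseenSlice_lift_repr_eq_zero {b₁ b₂ : UnitAddTorus d → EuclideanSpace ℝ d}
    (hb₁ : Continuous b₁) (hb₂ : Continuous b₂) {τ : ℝ} (hτ : 0 < τ) :
    ∫ x, oseenSlice τ (Torus.lift b₁) (Torus.lift b₂) (Torus.repr x) = 0 := by
  have h1 : ∀ x : UnitAddTorus d, oseenSlice τ (Torus.lift b₁) (Torus.lift b₂) (Torus.repr x) =
      ∫ z, oseenKernel τ z (b₁ (x - Torus.proj z)) (b₂ (x - Torus.proj z)) := by
    intro x
    rw [oseenSlice_eq_integral_sub]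
    simp_rw [lift_repr_sub]
  simp_rw [h1]
  obtain ⟨C₁, -, hC₁⟩ := TorusHeat.exists_norm_le hb₁
  obtain ⟨C₂, -, hC₂⟩ := TorusHeat.exists_norm_le hb₂
  obtain ⟨C, hC, hK⟩ := exists_norm_oseenKernel_le (E := EuclideanSpace ℝ d)
  -- Fubini over `𝕋ᵈ × ℝᵈ`
  set w : EuclideanSpace ℝ d → ℝ := fun z =>
    (τ + ‖z‖ ^ 2) ^ (-(((Module.finrank ℝ (EuclideanSpace ℝ d) : ℝ) + 1) / 2)) with hw
  have hint : Integrable (uncurry fun (x : UnitAddTorus d) (z : EuclideanSpace ℝ d) =>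
      oseenKernel τ z (b₁ (x - Torus.proj z)) (b₂ (x - Torus.proj z))) (volume.prod volume) := by
    refine Integrable.mono' (g := fun p => (1 : ℝ) * (C * C₁ * C₂ * w p.2))
      ((integrable_const (1 : ℝ)).mul_prod
        ((integrable_add_norm_sq_rpow_neg_half_succ hτ).const_mul (C * C₁ * C₂))) ?_ ?_
    · have hsh : Measurable fun p : UnitAddTorus d × EuclideanSpace ℝ d => p.1 - Torus.proj p.2 :=
        measurable_fst.sub (Torus.measurable_proj.comp measurable_snd)
      exact (Measurable.oseenKernel_comp measurable_const measurable_snd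
        (hb₁.measurable.comp hsh) (hb₂.measurable.comp hsh)).aestronglyMeasurable
    · refine Eventually.of_forall fun p => ?_
      have hwp : 0 ≤ C * w p.2 := mul_nonneg hC.le (Real.rpow_nonneg (by positivity) _)
      have hC₁0 : 0 ≤ C₁ := (norm_nonneg _).trans (hC₁ (p.1 - Torus.proj p.2))
      calc ‖uncurry (fun (x : UnitAddTorus d) (z : EuclideanSpace ℝ d) =>
              oseenKernel τ z (b₁ (x - Torus.proj z)) (b₂ (x - Torus.proj z))) p‖
          ≤ C * w p.2 * ‖b₁ (p.1 - Torus.proj p.2)‖ * ‖b₂ (p.1 - Torus.proj p.2)‖ :=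
            hK hτ p.2 _ _
        _ ≤ C * w p.2 * C₁ * C₂ :=
            mul_le_mul (mul_le_mul_of_nonneg_left (hC₁ _) hwp) (hC₂ _) (norm_nonneg _)
              (mul_nonneg hwp hC₁0)
        _ = 1 * (C * C₁ * C₂ * w p.2) := by ring
  rw [integral_integral_swap hint]
  have h2 : ∀ z : EuclideanSpace ℝ d,
      (∫ x, oseenKernel τ z (b₁ (x - Torus.proj z)) (b₂ (x - Torus.proj z))) =
        ∫ x, oseenKernel τ z (b₁ x) (b₂ x) := fun z =>
    integral_sub_right_eq_self (fun x => oseenKernel τ z (b₁ x) (b₂ x)) (Torus.proj z)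
  simp_rw [h2]
  -- the inner integral is odd in `z`
  have h := integral_neg_eq_self (fun z : EuclideanSpace ℝ d => ∫ x, oseenKernel τ z (b₁ x) (b₂ x))
    (volume : Measure (EuclideanSpace ℝ d))
  simp only [oseenKernel_neg, integral_neg] at h
  have h2 : (2 : ℝ) • ∫ z : EuclideanSpace ℝ d, ∫ x, oseenKernel τ z (b₁ x) (b₂ x) = 0 := by
    rw [two_smul]
    nth_rewrite 1 [← h]
    exact neg_add_cancel _
  exact (smul_eq_zero.1 h2).resolve_left two_ne_zero

/-- **The Duhamel term of a periodic field has zero average.** Let `v : ℝ → ℝᵈ → ℝᵈ` be jointly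
measurable with `‖v‖ ≤ M` on `(s, t) × ℝᵈ`, and suppose that every slice `v(σ)`, `σ ∈ (s, t)`,
is the lift of a continuous torus field `V(σ)`. Then for `ν > 0`,
`∫_{𝕋ᵈ} B^ν_s(v, v)(t)(repr x) dx = 0`: `B^ν_s(v,v)(t) = ∫ₛᵗ N_{ν(t−σ)}[v(σ), v(σ)] dσ`, Fubini in
`(x, σ)` under `‖N_σ[v, v]‖ ≤ C₀ σ^{-1/2} M²`, and `integral_oseenSlice_lift_repr_eq_zero` slice by
slice. [cite: KochNadirashviliSereginSverak2009, §3 p. 6 and §4 p. 8 (arXiv:0709.3599v1)] -/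
theorem integral_oseenDuhamel_repr_eq_zero
    {v : ℝ → EuclideanSpace ℝ d → EuclideanSpace ℝ d}
    {V : ℝ → UnitAddTorus d → EuclideanSpace ℝ d} {s t M ν : ℝ} (hν : 0 < ν)
    (hvm : Measurable (uncurry v)) (hvM : ∀ σ ∈ Ioo s t, ∀ y, ‖v σ y‖ ≤ M)
    (hV : ∀ σ ∈ Ioo s t, Continuous (V σ)) (hlift : ∀ σ ∈ Ioo s t, Torus.lift (V σ) = v σ) :
    ∫ x, oseenDuhamel ν s v v t (Torus.repr x) = 0 := by
  have h1 : ∀ y, oseenDuhamel ν s v v t y =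
      ∫ σ in Ioo s t, oseenSlice (ν * (t - σ)) (v σ) (v σ) y := fun y => rfl
  simp_rw [h1]
  obtain ⟨C₀, hC₀, hS⟩ := exists_norm_oseenSlice_le (E := EuclideanSpace ℝ d)
  -- Fubini over `𝕋ᵈ × (s, t)`
  have hint : Integrable (uncurry fun (x : UnitAddTorus d) (σ : ℝ) =>
      oseenSlice (ν * (t - σ)) (v σ) (v σ) (Torus.repr x)) (volume.prod (volume.restrict (Ioo s t))) := by
    refine Integrable.mono'
      (g := fun p => (1 : ℝ) * (C₀ * ν ^ (-(1 / 2 : ℝ)) * M * M * (t - p.2) ^ (-(1 / 2 : ℝ))))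
      ((integrable_const (1 : ℝ)).mul_prod
        ((integrableOn_Ioo_rpow_neg_half_sub s t).const_mul (C₀ * ν ^ (-(1 / 2 : ℝ)) * M * M)))
      ?_ ?_
    · have hsm := stronglyMeasurable_oseenSlice_duhamel ν t hvm hvm
      exact (hsm.comp_measurable
        (measurable_snd.prodMk (Torus.measurable_repr.comp measurable_fst))).aestronglyMeasurable
    · have hmem : ∀ᵐ p ∂((volume : Measure (UnitAddTorus d)).prod (volume.restrict (Ioo s t))),
          p.2 ∈ Ioo s t := by
        have hre : (volume : Measure (UnitAddTorus d)).prod (volume.restrict (Ioo s t)) =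
            ((volume : Measure (UnitAddTorus d)).prod volume).restrict (univ ×ˢ Ioo s t) := by
          rw [← Measure.prod_restrict, Measure.restrict_univ]
        rw [hre]
        filter_upwards [ae_restrict_mem (MeasurableSet.univ.prod measurableSet_Ioo)] with p hp
        exact (mem_prod.1 hp).2
      filter_upwards [hmem] with p hp
      have hσ : 0 < ν * (t - p.2) := mul_pos hν (sub_pos.2 hp.2)
      calc ‖uncurry (fun (x : UnitAddTorus d) (σ : ℝ) =>
              oseenSlice (ν * (t - σ)) (v σ) (v σ) (Torus.repr x)) p‖
          ≤ C₀ * (ν * (t - p.2)) ^ (-(1 / 2 : ℝ)) * M * M := hS hσ (hvM p.2 hp) (hvM p.2 hp) _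
        _ = 1 * (C₀ * ν ^ (-(1 / 2 : ℝ)) * M * M * (t - p.2) ^ (-(1 / 2 : ℝ))) := by
            rw [Real.mul_rpow hν.le (sub_pos.2 hp.2).le]; ring
  rw [integral_integral_swap hint]
  refine (setIntegral_congr_fun measurableSet_Ioo fun σ hσ => ?_).trans (integral_zero _ _)
  rw [← hlift σ hσ]
  exact integral_oseenSlice_lift_repr_eq_zero (hV σ hσ) (hV σ hσ) (mul_pos hν (sub_pos.2 hσ.2))

end Torus

end Literature.Analysis.FluidPDE

end
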